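import Mathlib
import HarnessLib
import Literature.MathematicalPhysics.QuantumLattice.GrassmannGramBoundedWeights
import Summits.HubbardSuperconductivity.HubbardSuperconductivity.Theorems.KLProgrammeKLRegimeTwoVolumeLipDoubledDefs
import Summits.HubbardSuperconductivity.HubbardSuperconductivity.Theorems.KLProgrammeKLRegimeTwoVolumeLipGluedWt

/-!
# Route `KLProgramme` — crux K3 ENGINE (stmt-HubbardSuperconductivity-20437), stub (e) proof-input «(e)-D-ROWS», keying (A′), REKEY-D file D2a:
# THE DATA OF THE DOUBLED DEEP BLOCK-STEP DOOR — Gram constant of the spectator covariance, weighted rows of `C ⊕ 0`, rows/columns of the doubled transfer `T ⊕ shift`,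
# parity and constant parts of the doubled objects (seat hubbard-kl-k3c4-p1 g27; design map HOME/hubbard-kl-k3c4-p1/REKEY-D.md §2 «LIP door⁺»)

The deep block-step door `…TwoVolumeLipDeepFirstOrder.sum_pinned_norm_kernel_map_born_sub_born_le_of_deep` is label-generic; by the doubled block identity (D1
`klLipBornD_eq_map_step`) the doubled tower reads it with `(f, C, g) := (id, klLipCovD, toLin' klLipTransferD)` (no synthesis).  Its data in that reading:

* §1 **`isGramBoundedR_klLipCovD`** — `IsGramBoundedR klLipCov κ → IsGramBoundedR (klLipCov ⊕ 0) κ` (Literature `IsGramBoundedR.submatrix` + `isGramBoundedR_mask`);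
* §2 generic rows: `rowSum_/colSum_spectator_wt_le` (weighted rows of `C ⊕ 0` against a weight read through `Prod.fst` = those of `C`), `colSum_norm_klPlainShift_le_one`,
  `rowSum_norm_klPlainShift_le_one`, `colSum_doubleBlock_le` (columns of `T ⊕ J` ≤ `a` when `1 ≤ a`), `rowSum_doubleBlock_filter_copy0` (a copy-`0` row of `T ⊕ J` on columns
  filtered through `Prod.fst` IS the `T`-row), `rowSum_doubleBlock_filter_copy1_le` (a copy-`1` row is `≤ 1` on any column family — the PLAIN pin's reading row);
* §3 parity / constant parts: `klLipInputD_mem_evenOdd_zero`, `constPart_klLipInputD`, `klGlueD_mem_evenOdd_zero`, `constPart_klGlueD`, `klLipInputDiffD_mem_evenOdd_zero`,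
  `constPart_klLipInputDiffD`.

Bookkeeping only; nothing asserts the (D) rows, (e), VL, K3 or superconductivity.  References: BGM 2006 §2.7 (2.70)–(2.71), §2.9 (4.3)–(4.6)
[cite: BenfattoGiulianiMastropietro2006]; de Siqueira Pedra–Salmhofer 2008 Thm 1.3 [cite: PedraSalmhofer2008].
-/

noncomputable section

namespace Summit.HubbardSuperconductivity.HubbardSuperconductivity.Theorems.TwoVolumeLip

set_option linter.dupNamespace false -- summit = problem name (single-conjunct summit), D-0017

open Finset Literature.MathematicalPhysics.QuantumLattice GrassmannAlgebra Literature.Probability.LatticeModels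
open Literature.MathematicalPhysics.QuantumLattice.FermiRG
open Summit.HubbardSuperconductivity.HubbardSuperconductivity.Theorems.KLRegimeSplit
open Summit.HubbardSuperconductivity.HubbardSuperconductivity.Theorems.KLProgrammeLegKernels
open Summit.HubbardSuperconductivity.HubbardSuperconductivity.Theorems.EngineV8
open Summit.HubbardSuperconductivity.HubbardSuperconductivity.Theorems.TwoVolumeSource
open Summit.HubbardSuperconductivity.HubbardSuperconductivity.Theorems.TwoVolumeDefect

/-! ## D2a §1 The Gram datum of the spectator covariance -/

section GramD

variable {V M : ℕ} [NeZero V]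

/-- **The spectator lift keeps the Gram constant**: `IsGramBoundedR (klLipCov … d k) κ → IsGramBoundedR (klLipCovD … d k) κ` (`C ⊕ 0` is the copy-`0` mask of the pull-back
of `C` along `Prod.fst`: Literature `IsGramBoundedR.submatrix` + `isGramBoundedR_mask`). [cite: PedraSalmhofer2008, Thm 1.3] -/
theorem isGramBoundedR_klLipCovD {β μ : ℝ} {K : TrigPolyC4v} {d k : ℕ} {κ : ℝ} (h : IsGramBoundedR (klLipCov V M β μ K d k) κ) :
    IsGramBoundedR (klLipCovD V M β μ K d k) κ := by
  classical
  refine isGramBoundedR_mask (h.submatrix (Prod.fst : SrcLabel V M (d * k - 1) → SpaceTimeIdx V M × SectorLeg (sectorCount (d * k - 1))))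
    {p : SrcLabel V M (d * k - 1) | p.2 = 0} _ (fun X Y => ?_)
  rw [klLipCovD_apply]
  simp only [Set.mem_setOf_eq, Matrix.submatrix_apply]

end GramD

/-! ## D2a §2 Weighted rows of the spectator covariance and the rows / columns of the doubled transfer -/

section RowsD

variable {Γ₁ Γ₂ : Type*} [Fintype Γ₁] [DecidableEq Γ₁] [Fintype Γ₂] [DecidableEq Γ₂]

omit [Fintype Γ₂] [DecidableEq Γ₂] in
/-- **Weighted ROW sums of a spectator lift** `D = C ⊕ 0` against a weight read through `Prod.fst`: `Σ_q ‖D p q‖·wt({p,q}.image fst) ≤ α` from the rows of `C` (`0 ≤ α`). -/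
theorem rowSum_spectator_wt_le (C : Matrix Γ₁ Γ₁ ℂ) (wt : Finset Γ₁ → ℝ) {α : ℝ} (hα : 0 ≤ α)
    (hrow : ∀ X, ∑ Y, ‖C X Y‖ * wt {X, Y} ≤ α) (D : Matrix (Γ₁ × Fin 2) (Γ₁ × Fin 2) ℂ)
    (hD : ∀ p q, D p q = if p.2 = 0 ∧ q.2 = 0 then C p.1 q.1 else 0) (p : Γ₁ × Fin 2) :
    ∑ q, ‖D p q‖ * wt (({p, q} : Finset (Γ₁ × Fin 2)).image Prod.fst) ≤ α := by
  have h10 : ¬ ((1 : Fin 2) = 0) := by decide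
  by_cases hp : p.2 = 0
  · rw [Fintype.sum_prod_type]
    simp only [Fin.sum_univ_two, hD, hp, true_and, if_true, h10, if_false, norm_zero, zero_mul, add_zero]
    refine (le_of_eq (Finset.sum_congr rfl fun y _ => ?_)).trans (hrow p.1)
    congr 1
    simp [Finset.image_insert, Finset.image_singleton]
  · have hz : ∀ q, D p q = 0 := fun q => by rw [hD, if_neg (fun h => hp h.1)]
    simp only [hz, norm_zero, zero_mul, Finset.sum_const_zero]
    exact hα

omit [Fintype Γ₂] [DecidableEq Γ₂] in
/-- **Weighted COLUMN sums of a spectator lift.** -/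
theorem colSum_spectator_wt_le (C : Matrix Γ₁ Γ₁ ℂ) (wt : Finset Γ₁ → ℝ) {α : ℝ} (hα : 0 ≤ α)
    (hcol : ∀ Y, ∑ X, ‖C X Y‖ * wt {X, Y} ≤ α) (D : Matrix (Γ₁ × Fin 2) (Γ₁ × Fin 2) ℂ)
    (hD : ∀ p q, D p q = if p.2 = 0 ∧ q.2 = 0 then C p.1 q.1 else 0) (q : Γ₁ × Fin 2) :
    ∑ p, ‖D p q‖ * wt (({p, q} : Finset (Γ₁ × Fin 2)).image Prod.fst) ≤ α := by
  have h10 : ¬ ((1 : Fin 2) = 0) := by decide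
  by_cases hq : q.2 = 0
  · rw [Fintype.sum_prod_type]
    simp only [Fin.sum_univ_two, hD, hq, and_true, if_true, h10, if_false, norm_zero, zero_mul, add_zero]
    refine (le_of_eq (Finset.sum_congr rfl fun x _ => ?_)).trans (hcol q.1)
    congr 1
    simp [Finset.image_insert, Finset.image_singleton]
  · have hz : ∀ p, D p q = 0 := fun p => by rw [hD, if_neg (fun h => hq h.2)]
    simp only [hz, norm_zero, zero_mul, Finset.sum_const_zero]
    exact hα

end RowsD

section ShiftRows

variable {V M : ℕ} [NeZero V] {N N' : ℕ}

omit [NeZero V] in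
/-- The plain shift has at most one nonzero entry per COLUMN, of norm `1`: `Σ_{Y′} ‖klPlainShift N′ N Y′ Y‖ ≤ 1` (`N′` has the slot `0`). -/
theorem colSum_norm_klPlainShift_le_one [Fintype (SpaceTimeIdx V M × SectorLeg N')] (hN' : 0 < N') (Y : SpaceTimeIdx V M × SectorLeg N) :
    ∑ Y' : SpaceTimeIdx V M × SectorLeg N', ‖klPlainShift V M N' N Y' Y‖ ≤ 1 := by
  by_cases h0 : (Y.2.1.1 : ℕ) = 0
  · set Y₀ : SpaceTimeIdx V M × SectorLeg N' := (Y.1, ((⟨0, hN'⟩, Y.2.1.2), Y.2.2)) with hY₀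
    rw [Finset.sum_eq_single Y₀]
    · rw [klPlainShift_apply]; split_ifs <;> simp
    · intro Y' _ hY'
      rw [klPlainShift_apply, if_neg, norm_zero]
      rintro ⟨h1, h2, -, h4, h5⟩
      exact hY' (by rw [hY₀]; exact Prod.ext h1 (Prod.ext (Prod.ext (Fin.ext h2) h4) h5))
    · intro h; exact absurd (Finset.mem_univ _) h
  · have hz : ∀ Y', klPlainShift V M N' N Y' Y = 0 := fun Y' => by
      rw [klPlainShift_apply, if_neg]
      rintro ⟨-, -, h3, -⟩
      exact h0 h3
    simp [hz]

omit [NeZero V] in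
/-- The plain shift has at most one nonzero entry per ROW, of norm `1`, on any sub-family of columns: `Σ_{Y ∈ s} ‖klPlainShift N′ N Y′ Y‖ ≤ 1` (`N` has the slot `0`). -/
theorem rowSum_norm_klPlainShift_le_one [Fintype (SpaceTimeIdx V M × SectorLeg N)] (hN : 0 < N) (Y' : SpaceTimeIdx V M × SectorLeg N')
    (s : Finset (SpaceTimeIdx V M × SectorLeg N)) :
    ∑ Y ∈ s, ‖klPlainShift V M N' N Y' Y‖ ≤ 1 := by
  refine (Finset.sum_le_sum_of_subset_of_nonneg (Finset.subset_univ s) fun _ _ _ => norm_nonneg _).trans ?_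
  by_cases h0 : (Y'.2.1.1 : ℕ) = 0
  · set Y₀ : SpaceTimeIdx V M × SectorLeg N := (Y'.1, ((⟨0, hN⟩, Y'.2.1.2), Y'.2.2)) with hY₀
    rw [Finset.sum_eq_single Y₀]
    · rw [klPlainShift_apply]; split_ifs <;> simp
    · intro Y _ hY
      rw [klPlainShift_apply, if_neg, norm_zero]
      rintro ⟨h1, -, h3, h4, h5⟩
      exact hY (by rw [hY₀]; exact Prod.ext h1.symm (Prod.ext (Prod.ext (Fin.ext h3) h4.symm) h5.symm))
    · intro h; exact absurd (Finset.mem_univ _) h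
  · have hz : ∀ Y, klPlainShift V M N' N Y' Y = 0 := fun Y => by
      rw [klPlainShift_apply, if_neg]
      rintro ⟨-, h2, -⟩
      exact h0 h2
    simp [hz]

end ShiftRows

section TransferD

variable {Γ₁ Γ₂ : Type*} [Fintype Γ₁] [DecidableEq Γ₁] [Fintype Γ₂] [DecidableEq Γ₂]
  (T J : Matrix Γ₂ Γ₁ ℂ) (Tp : Matrix (Γ₂ × Fin 2) (Γ₁ × Fin 2) ℂ)
  (hTp : ∀ p' p, Tp p' p = if p'.2 = 0 ∧ p.2 = 0 then T p'.1 p.1 else if p'.2 = 1 ∧ p.2 = 1 then J p'.1 p.1 else 0)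
include hTp

omit [Fintype Γ₁] [DecidableEq Γ₁] [DecidableEq Γ₂] in
/-- **COLUMN sums of a doubled block `T ⊕ J`**: `≤ a` if the columns of `T` are `≤ a` and those of `J` are `≤ 1 ≤ a`. -/
theorem colSum_doubleBlock_le {a : ℝ} (ha : ∀ y, ∑ x, ‖T x y‖ ≤ a) (hJ : ∀ y, ∑ x, ‖J x y‖ ≤ 1) (ha1 : 1 ≤ a) (y' : Γ₁ × Fin 2) :
    ∑ x', ‖Tp x' y'‖ ≤ a := by
  have h10 : ¬ ((1 : Fin 2) = 0) := by decide
  have h01 : ¬ ((0 : Fin 2) = 1) := by decide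
  rw [Fintype.sum_prod_type]
  rcases Fin.exists_fin_two.1 ⟨y'.2, rfl⟩ with h | h
  · simp only [Fin.sum_univ_two, hTp, h, and_true, if_true, h10, h01, if_false, and_false, norm_zero, add_zero]
    exact ha y'.1
  · simp only [Fin.sum_univ_two, hTp, h, h10, h01, and_true, and_false, if_false, if_true, norm_zero, zero_add]
    exact (hJ y'.1).trans ha1

omit [Fintype Γ₂] [DecidableEq Γ₂] [DecidableEq Γ₁] in
/-- **ROW sums of a doubled block at a copy-`0` row, on a sub-family of columns read through `Prod.fst`**: `= Σ_{y ∈ filter Q} ‖T w y‖` (only copy-`0` columns count). -/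
theorem rowSum_doubleBlock_filter_copy0 (Q : Γ₁ → Prop) [DecidablePred Q] (w' : Γ₂ × Fin 2) (hw : w'.2 = 0) :
    ∑ y' ∈ univ.filter (fun y' : Γ₁ × Fin 2 => Q y'.1), ‖Tp w' y'‖ = ∑ y ∈ univ.filter Q, ‖T w'.1 y‖ := by
  have h10 : ¬ ((1 : Fin 2) = 0) := by decide
  have h01 : ¬ ((0 : Fin 2) = 1) := by decide
  rw [Finset.sum_filter, Finset.sum_filter, Fintype.sum_prod_type]
  refine Finset.sum_congr rfl fun y _ => ?_
  simp only [Fin.sum_univ_two, hTp, hw, true_and, if_true, h10, h01, if_false, false_and, norm_zero]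
  split_ifs <;> simp

omit [Fintype Γ₂] [DecidableEq Γ₂] [DecidableEq Γ₁] in
/-- **ROW sums of a doubled block at a copy-`1` row, on any sub-family of columns**: `≤ 1` if the rows of `J` are `≤ 1` on sub-families. -/
theorem rowSum_doubleBlock_filter_copy1_le (hJ : ∀ x (s : Finset Γ₁), ∑ y ∈ s, ‖J x y‖ ≤ 1) (P : Γ₁ × Fin 2 → Prop) [DecidablePred P]
    (w' : Γ₂ × Fin 2) (hw : w'.2 = 1) :
    ∑ y' ∈ univ.filter P, ‖Tp w' y'‖ ≤ 1 := by
  have h10 : ¬ ((1 : Fin 2) = 0) := by decide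
  have h01 : ¬ ((0 : Fin 2) = 1) := by decide
  refine (Finset.sum_le_sum_of_subset_of_nonneg (Finset.subset_univ _) fun _ _ _ => norm_nonneg _).trans ?_
  rw [Fintype.sum_prod_type]
  simp only [Fin.sum_univ_two, hTp, hw, h10, h01, false_and, if_false, true_and, if_true, norm_zero, zero_add]
  simpa using hJ w'.1 univ

end TransferD

/-! ## D2a §3 Parity and constant parts of the doubled objects -/

section ParityD

variable {V M : ℕ} [NeZero V]

/-- The doubled analysed input is even when the input is. -/
theorem klLipInputD_mem_evenOdd_zero {β U μ : ℝ} {K : TrigPolyC4v} {d k : ℕ} (h : klTowerInput V M β U μ K d k ∈ evenOdd ℂ 0) :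
    klLipInputD V M β U μ K d k ∈ evenOdd ℂ 0 :=
  map_mem_evenOdd_zero ℂ _ h

/-- The constant part of the doubled analysed input is that of the input. -/
theorem constPart_klLipInputD (β U μ : ℝ) (K : TrigPolyC4v) (d k : ℕ) :
    constPart ℂ (klLipInputD V M β U μ K d k) = constPart ℂ (klTowerInput V M β U μ K d k) := by
  rw [klLipInputD_def, constPart_map]

variable {L b : ℕ} [NeZero L] [NeZero (b * L)] {n : ℕ}

/-- The doubled glue of an even element is even. -/
theorem klGlueD_mem_evenOdd_zero {W : GrassmannAlgebra ℂ (SrcLabel L M n)} (hW : W ∈ evenOdd ℂ 0) : klGlueD L b M n W ∈ evenOdd ℂ 0 :=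
  Submodule.sum_mem _ fun β _ => map_mem_evenOdd_zero ℂ (klBlockEmbD L b M n β) hW

/-- The constant part of the doubled glue of an element without constant part vanishes. -/
theorem constPart_klGlueD {W : GrassmannAlgebra ℂ (SrcLabel L M n)} (hW : constPart ℂ W = 0) : constPart ℂ (klGlueD L b M n W) = 0 := by
  rw [klGlueD, map_sum]
  exact sum_eq_zero fun β _ => by rw [constPart_map, hW]

/-- The doubled input difference is even when both inputs are. -/
theorem klLipInputDiffD_mem_evenOdd_zero {β U μ : ℝ} {K : TrigPolyC4v} {d k : ℕ}
    (hf : klTowerInput (b * L) M β U μ K d k ∈ evenOdd ℂ 0) (hc : klTowerInput L M β U μ K d k ∈ evenOdd ℂ 0) :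
    klLipInputDiffD L b M β U μ K d k ∈ evenOdd ℂ 0 :=
  sub_mem (klLipInputD_mem_evenOdd_zero hf) (klGlueD_mem_evenOdd_zero (klLipInputD_mem_evenOdd_zero hc))

/-- The doubled input difference has no constant part when the inputs have none. -/
theorem constPart_klLipInputDiffD {β U μ : ℝ} {K : TrigPolyC4v} {d k : ℕ}
    (hf : constPart ℂ (klTowerInput (b * L) M β U μ K d k) = 0) (hc : constPart ℂ (klTowerInput L M β U μ K d k) = 0) :
    constPart ℂ (klLipInputDiffD L b M β U μ K d k) = 0 := by
  rw [klLipInputDiffD, map_sub, constPart_klLipInputD, hf, constPart_klGlueD (by rw [constPart_klLipInputD, hc]), sub_zero]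

end ParityD

end Summit.HubbardSuperconductivity.HubbardSuperconductivity.Theorems.TwoVolumeLip

end
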